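import Summits.KontsevichZagierPeriods.Zeta5Search.Certificates.VIMInnerModuleN
import Summits.KontsevichZagierPeriods.Zeta5Search.Certificates.PolyReflectPack
import HarnessLib

/-!
# ζ(5) search — brown9: the level-1 `T`-module relations as kernel-reduction relation instances (cell `pub-zeta5`, certifier `cert-2`)

HONEST FRAMING: systematic search; no irrationality claim unless certified.

Glue between cert-1's PROVED level-1 relations of the inner block `T(n;p,q)` (`VIMInner.T_rel_P2` (order 2 in `p`),
`T_rel_M3` (three-term contiguity), `T_rel_N1` (`n`-shift); `Certificates/VIMInnerModule(N).lean`) and the reflection /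
module-reduction algebra `PolyReflect3`/`PolyReflectPack`: for the level-2/3 certificates of the ttrl2 lane (VIM.md §7) the
T-SYMBOLS are `T(n+i; P+j, Q+l)` with `P = 3n − x − k`, `Q = 2n − k` (`x = k₃` rational, `k = k₅`), listed in a table
`tab : List (ℕ × ℤ × ℤ)` and valued by `Tv tab n x k`; a relation INSTANCE `instP2 i j l s₀ s₁ s₂` (resp. `instM3`, `instN1`) is the
formal combination whose coefficients are the level-1 coefficient polynomials composed with the affine forms
(`subst3`, templates `tP2c0 … tN1cp` in the variables `(n', p, q)`), and `lcEval_instP2/M3/N1` say it evaluates to `0`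
whenever the three symbol indices carry the right offsets — by the tree theorems. Also: non-vanishing of linear-form pivots
at non-integral `x` (`linQ_ne_zero_of_not_int`) and for integer forms (`linQ_ne_zero_of_int`).
-/

namespace Summit.KontsevichZagierPeriods.Zeta5Search.Certificates

namespace VIMInner

open Summit.KontsevichZagierPeriods.Zeta5Search.PolyReflect

/-! ### The level-1 coefficient templates (variables `(n', p, q)` in the slots `(w, x, k)` of `Poly3`) -/

/-- `(p+1−n')(n'+p−q+1)` — coefficient of `T(p)` in (P2). -/
def tP2c0 : Poly3 := [[[1, 0, -1], [2], [1]], [[-1, 1], [-1]]]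
/-- `n'²+2n'p−2n'q+3n'−2p²+2pq−5p+3q−3` — coefficient of `T(p+1)` in (P2). -/
def tP2c1 : Poly3 := [[[-3, 3, 1], [-5, 2], [-2]], [[3, -2], [2]]]
/-- `(p+2−n')(p−q+1−n')` — coefficient of `T(p+2)` in (P2). -/
def tP2c2 : Poly3 := [[[2, -3, 1], [3, -2], [1]], [[-2, 1], [-1]]]
/-- `(p−q)(p+q+2−2n')` — coefficient of `T(p,q)` in (M3). -/
def tM3c0 : Poly3 := [[[], [2, -2], [1]], [[-2, 2]], [[-1]]]
/-- `−(p+1−n')(p−q−n')` — coefficient of `T(p+1,q)` in (M3). -/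
def tM3c1 : Poly3 := [[[0, 1, -1], [-1, 2], [-1]], [[1, -1], [1]]]
/-- `−(q+1−n')(n'+p−q)` — coefficient of `T(p,q+1)` in (M3). -/
def tM3c2 : Poly3 := [[[0, -1, 1], [-1, 1]], [[1, -2], [-1]], [[1]]]
/-- `cN1 = −(p−n')(q−n')(n'+1)²` — coefficient of `T(n'+1;p,q)` in (N1). -/
def tN1c1 : Poly3 := [[[0, 0, -1, -2, -1], [0, 1, 2, 1]], [[0, 1, 2, 1], [-1, -2, -1]]]
/-- `cN0` — coefficient of `T(n';p,q)` in (N1). -/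
def tN1c0 : Poly3 :=
  [[[0, -1, -6, -13, -8], [1, 5, 10, 2], [0, 1, 7], [-1, -3]], [[-1, -1, 8, 12], [-2, -12, -12], [3, -1], [2]],
    [[1, 1, -4], [0, 6], [-2]]]
/-- `cNp` — coefficient of `T(n';p+1,q)` in (N1). -/
def tN1cp : Poly3 :=
  [[[0, 1, 3, 1, -5], [-1, -3, 1, 13], [0, -3, -11], [1, 3]], [[1, 2, -1, -2], [1, 5], [-2, 4], [-2]],
    [[-1, -2, 3], [1, -5], [2]]]

/-- Value of `tP2c0`. -/
theorem ev3_tP2c0 (a b c : ℚ) : ev3 tP2c0 a b c = (b + 1 - a) * (a + b - c + 1) := by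
  simp [tP2c0, ev2, ev1]; ring
/-- Value of `tP2c1`. -/
theorem ev3_tP2c1 (a b c : ℚ) :
    ev3 tP2c1 a b c = a ^ 2 + 2 * a * b - 2 * a * c + 3 * a - 2 * b ^ 2 + 2 * b * c - 5 * b + 3 * c - 3 := by
  simp [tP2c1, ev2, ev1]; ring
/-- Value of `tP2c2`. -/
theorem ev3_tP2c2 (a b c : ℚ) : ev3 tP2c2 a b c = (b + 2 - a) * (b - c + 1 - a) := by
  simp [tP2c2, ev2, ev1]; ring
/-- Value of `tM3c0`. -/
theorem ev3_tM3c0 (a b c : ℚ) : ev3 tM3c0 a b c = (b - c) * (b + c + 2 - 2 * a) := by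
  simp [tM3c0, ev2, ev1]; ring
/-- Value of `tM3c1`. -/
theorem ev3_tM3c1 (a b c : ℚ) : ev3 tM3c1 a b c = -((b + 1 - a) * (b - c - a)) := by
  simp [tM3c1, ev2, ev1]; ring
/-- Value of `tM3c2`. -/
theorem ev3_tM3c2 (a b c : ℚ) : ev3 tM3c2 a b c = -((c + 1 - a) * (a + b - c)) := by
  simp [tM3c2, ev2, ev1]; ring
/-- Value of `tN1c1` (`= cN1`). -/
theorem ev3_tN1c1 (a b c : ℚ) : ev3 tN1c1 a b c = cN1 a b c := by
  simp [tN1c1, cN1, ev2, ev1]; ring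
/-- Value of `tN1c0` (`= cN0`). -/
theorem ev3_tN1c0 (a b c : ℚ) : ev3 tN1c0 a b c = cN0 a b c := by
  simp [tN1c0, cN0, ev2, ev1]; ring
/-- Value of `tN1cp` (`= cNp`). -/
theorem ev3_tN1cp (a b c : ℚ) : ev3 tN1cp a b c = cNp a b c := by
  simp [tN1cp, cNp, ev2, ev1]; ring

/-! ### Symbols and their values -/

/-- Value of symbol number `s` of the table `tab`: the entry `(i, j, l)` denotes `T(n+i; 3n−x−k+j, 2n−k+l)`
(`0` past the end of the table). -/
def Tv (tab : List (ℕ × ℤ × ℤ)) (n : ℕ) (x : ℚ) (k : ℕ) (s : ℕ) : ℚ :=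
  match tab[s]? with
  | some (i, j, l) => T (n + i) (3 * (n : ℚ) - x - k + j) (2 * (n : ℚ) - k + l)
  | none => 0

/-- The value of a tabulated symbol. -/
theorem Tv_of_eq {tab : List (ℕ × ℤ × ℤ)} {s : ℕ} {i : ℕ} {j l : ℤ} (h : tab[s]? = some (i, j, l)) (n : ℕ) (x : ℚ)
    (k : ℕ) : Tv tab n x k s = T (n + i) (3 * (n : ℚ) - x - k + j) (2 * (n : ℚ) - k + l) := by
  simp [Tv, h]

/-! ### Relation instances -/

/-- The affine arguments of an instance at `(n+i; P+j, Q+l)` as `Poly3` linear forms in `(w, x, k) = (n, x, k)`. -/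
def argN (i : ℕ) : Poly3 := lin3 1 0 0 i
/-- `P + j = 3n − x − k + j`. -/
def argP (j : ℤ) : Poly3 := lin3 3 (-1) (-1) j
/-- `Q + l = 2n − k + l`. -/
def argQ (l : ℤ) : Poly3 := lin3 2 0 (-1) l

/-- Generic (P2) instance: coefficient templates composed with argument trees `N, P, Q` (values `n', p, q`), placed on
the symbols `s₀, s₁, s₂` (values `T(n';p,q)·V`, `T(n';p+1,q)·V`, `T(n';p+2,q)·V` for a common factor `V`). -/
def instP2g (N P Q : Poly3) (s₀ s₁ s₂ : ℕ) : LC :=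
  rel3 s₀ (subst3 N P Q tP2c0) s₁ (subst3 N P Q tP2c1) s₂ (subst3 N P Q tP2c2)

/-- Generic (M3) instance (symbols valued `T(n';p,q)·V`, `T(n';p+1,q)·V`, `T(n';p,q+1)·V`). -/
def instM3g (N P Q : Poly3) (s₀ s₁ s₂ : ℕ) : LC :=
  rel3 s₀ (subst3 N P Q tM3c0) s₁ (subst3 N P Q tM3c1) s₂ (subst3 N P Q tM3c2)

/-- Generic (N1) instance (symbols valued `T(n'+1;p,q)·V`, `T(n';p,q)·V`, `T(n';p+1,q)·V`). -/
def instN1g (N P Q : Poly3) (s₀ s₁ s₂ : ℕ) : LC :=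
  rel3 s₀ (subst3 N P Q tN1c1) s₁ (subst3 N P Q tN1c0) s₂ (subst3 N P Q tN1cp)

/-- **Generic (P2) instances evaluate to zero** (`n' ≥ 2`; any common factor `V`, e.g. the other tensor factor). -/
theorem lcEval_instP2g (Tval : ℕ → ℚ) (w x k : ℚ) (N P Q : Poly3) (s₀ s₁ s₂ : ℕ) (n : ℕ) (hn : 2 ≤ n) (p q V : ℚ)
    (hN : ev3 N w x k = n) (hP : ev3 P w x k = p) (hQ : ev3 Q w x k = q)
    (h₀ : Tval s₀ = T n p q * V) (h₁ : Tval s₁ = T n (p + 1) q * V) (h₂ : Tval s₂ = T n (p + 2) q * V) :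
    lcEval Tval w x k 0 (instP2g N P Q s₀ s₁ s₂) = 0 := by
  rw [instP2g, lcEval_rel3, ev3_subst3, ev3_subst3, ev3_subst3, hN, hP, hQ, ev3_tP2c0, ev3_tP2c1, ev3_tP2c2,
    h₀, h₁, h₂]
  linear_combination V * T_rel_P2 n hn p q

/-- **Generic (M3) instances evaluate to zero** (`n' ≥ 1`). -/
theorem lcEval_instM3g (Tval : ℕ → ℚ) (w x k : ℚ) (N P Q : Poly3) (s₀ s₁ s₂ : ℕ) (n : ℕ) (hn : 1 ≤ n) (p q V : ℚ)
    (hN : ev3 N w x k = n) (hP : ev3 P w x k = p) (hQ : ev3 Q w x k = q)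
    (h₀ : Tval s₀ = T n p q * V) (h₁ : Tval s₁ = T n (p + 1) q * V) (h₂ : Tval s₂ = T n p (q + 1) * V) :
    lcEval Tval w x k 0 (instM3g N P Q s₀ s₁ s₂) = 0 := by
  rw [instM3g, lcEval_rel3, ev3_subst3, ev3_subst3, ev3_subst3, hN, hP, hQ, ev3_tM3c0, ev3_tM3c1, ev3_tM3c2,
    h₀, h₁, h₂]
  linear_combination V * T_rel_M3 n hn p q

/-- **Generic (N1) instances evaluate to zero** (`n' ≥ 1`). -/
theorem lcEval_instN1g (Tval : ℕ → ℚ) (w x k : ℚ) (N P Q : Poly3) (s₀ s₁ s₂ : ℕ) (n : ℕ) (hn : 1 ≤ n) (p q V : ℚ)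
    (hN : ev3 N w x k = n) (hP : ev3 P w x k = p) (hQ : ev3 Q w x k = q)
    (h₀ : Tval s₀ = T (n + 1) p q * V) (h₁ : Tval s₁ = T n p q * V) (h₂ : Tval s₂ = T n (p + 1) q * V) :
    lcEval Tval w x k 0 (instN1g N P Q s₀ s₁ s₂) = 0 := by
  rw [instN1g, lcEval_rel3, ev3_subst3, ev3_subst3, ev3_subst3, hN, hP, hQ, ev3_tN1c1, ev3_tN1c0, ev3_tN1cp,
    h₀, h₁, h₂]
  linear_combination V * T_rel_N1 n hn p q

/-- Instance of (P2) at `(n+i; P+j, Q+l)` on the symbols `s₀ = (i,j,l)`, `s₁ = (i,j+1,l)`, `s₂ = (i,j+2,l)`. -/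
def instP2 (i : ℕ) (j l : ℤ) (s₀ s₁ s₂ : ℕ) : LC := instP2g (argN i) (argP j) (argQ l) s₀ s₁ s₂

/-- Instance of (M3) at `(n+i; P+j, Q+l)` on the symbols `s₀ = (i,j,l)`, `s₁ = (i,j+1,l)`, `s₂ = (i,j,l+1)`. -/
def instM3 (i : ℕ) (j l : ℤ) (s₀ s₁ s₂ : ℕ) : LC := instM3g (argN i) (argP j) (argQ l) s₀ s₁ s₂

/-- Instance of (N1) at `(n+i; P+j, Q+l)` on the symbols `s₀ = (i+1,j,l)`, `s₁ = (i,j,l)`, `s₂ = (i,j+1,l)`. -/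
def instN1 (i : ℕ) (j l : ℤ) (s₀ s₁ s₂ : ℕ) : LC := instN1g (argN i) (argP j) (argQ l) s₀ s₁ s₂

/-- Values of the affine arguments. -/
theorem ev3_args (i : ℕ) (j l : ℤ) (n : ℕ) (x : ℚ) (k : ℕ) :
    ev3 (argN i) n x k = ((n + i : ℕ) : ℚ) ∧ ev3 (argP j) n x k = 3 * (n : ℚ) - x - k + j ∧
      ev3 (argQ l) n x k = 2 * (n : ℚ) - k + l := by
  refine ⟨?_, ?_, ?_⟩ <;> simp [argN, argP, argQ] <;> ring

/-- **(P2) instances evaluate to zero** (`n + i ≥ 2`). -/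
theorem lcEval_instP2 (tab : List (ℕ × ℤ × ℤ)) (n : ℕ) (x : ℚ) (k : ℕ) (i : ℕ) (j l : ℤ) (s₀ s₁ s₂ : ℕ)
    (hn : 2 ≤ n + i) (h₀ : tab[s₀]? = some (i, j, l)) (h₁ : tab[s₁]? = some (i, j + 1, l))
    (h₂ : tab[s₂]? = some (i, j + 2, l)) : lcEval (Tv tab n x k) n x k 0 (instP2 i j l s₀ s₁ s₂) = 0 := by
  obtain ⟨eN, eP, eQ⟩ := ev3_args i j l n x k
  refine lcEval_instP2g _ _ _ _ _ _ _ _ _ _ (n + i) hn _ _ 1 eN eP eQ ?_ ?_ ?_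
  · rw [Tv_of_eq h₀, mul_one]
  · rw [Tv_of_eq h₁, mul_one]; push_cast; ring_nf
  · rw [Tv_of_eq h₂, mul_one]; push_cast; ring_nf

/-- **(M3) instances evaluate to zero** (`n + i ≥ 1`). -/
theorem lcEval_instM3 (tab : List (ℕ × ℤ × ℤ)) (n : ℕ) (x : ℚ) (k : ℕ) (i : ℕ) (j l : ℤ) (s₀ s₁ s₂ : ℕ)
    (hn : 1 ≤ n + i) (h₀ : tab[s₀]? = some (i, j, l)) (h₁ : tab[s₁]? = some (i, j + 1, l))
    (h₂ : tab[s₂]? = some (i, j, l + 1)) : lcEval (Tv tab n x k) n x k 0 (instM3 i j l s₀ s₁ s₂) = 0 := by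
  obtain ⟨eN, eP, eQ⟩ := ev3_args i j l n x k
  refine lcEval_instM3g _ _ _ _ _ _ _ _ _ _ (n + i) hn _ _ 1 eN eP eQ ?_ ?_ ?_
  · rw [Tv_of_eq h₀, mul_one]
  · rw [Tv_of_eq h₁, mul_one]; push_cast; ring_nf
  · rw [Tv_of_eq h₂, mul_one]; push_cast; ring_nf

/-- **(N1) instances evaluate to zero** (`n + i ≥ 1`). -/
theorem lcEval_instN1 (tab : List (ℕ × ℤ × ℤ)) (n : ℕ) (x : ℚ) (k : ℕ) (i : ℕ) (j l : ℤ) (s₀ s₁ s₂ : ℕ)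
    (hn : 1 ≤ n + i) (h₀ : tab[s₀]? = some (i + 1, j, l)) (h₁ : tab[s₁]? = some (i, j, l))
    (h₂ : tab[s₂]? = some (i, j + 1, l)) : lcEval (Tv tab n x k) n x k 0 (instN1 i j l s₀ s₁ s₂) = 0 := by
  obtain ⟨eN, eP, eQ⟩ := ev3_args i j l n x k
  refine lcEval_instN1g _ _ _ _ _ _ _ _ _ _ (n + i) hn _ _ 1 eN eP eQ ?_ ?_ ?_
  · rw [Tv_of_eq h₀, mul_one, show n + (i + 1) = n + i + 1 by ring]
  · rw [Tv_of_eq h₁, mul_one]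
  · rw [Tv_of_eq h₂, mul_one]; push_cast; ring_nf

/-! ### Non-vanishing of linear-form multipliers -/

/-- A linear form `a·n ± x + c·k + d` does not vanish when `x` is not an integer. -/
theorem linQ_ne_zero_of_not_int {x : ℚ} (hx : ∀ z : ℤ, x ≠ z) (a b c d : ℤ) (hb : b = 1 ∨ b = -1) (n k : ℕ) :
    (a : ℚ) * n + (b : ℚ) * x + (c : ℚ) * k + (d : ℚ) ≠ 0 := by
  intro h
  rcases hb with rfl | rfl
  · push_cast at h
    apply hx (-(a * n + c * k + d)); push_cast; linarith
  · push_cast at h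
    apply hx (a * n + c * k + d); push_cast; linarith

/-- A linear form `a·n + c·k + d` (no `x`) does not vanish when the integer `a·n + c·k + d` is non-zero. -/
theorem linQ_ne_zero_of_int {x : ℚ} (a c d : ℤ) (n k : ℕ) (h : a * n + c * k + d ≠ 0) :
    (a : ℚ) * n + ((0 : ℤ) : ℚ) * x + (c : ℚ) * k + (d : ℚ) ≠ 0 := by
  intro h'
  push_cast at h'
  apply h
  have : ((a * n + c * k + d : ℤ) : ℚ) = 0 := by push_cast; linarith
  exact_mod_cast this

/-- The multiplier `mul3 (lin3 a₁ b₁ c₁ d₁) (lin3 a₂ b₂ c₂ d₂)` evaluates to the product of the two linear forms. -/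
theorem ev3_mul3_lin3 (a₁ b₁ c₁ d₁ a₂ b₂ c₂ d₂ : ℤ) (w x k : ℚ) :
    ev3 (mul3 (lin3 a₁ b₁ c₁ d₁) (lin3 a₂ b₂ c₂ d₂)) w x k =
      ((a₁ : ℚ) * w + (b₁ : ℚ) * x + (c₁ : ℚ) * k + (d₁ : ℚ)) * ((a₂ : ℚ) * w + (b₂ : ℚ) * x + (c₂ : ℚ) * k + (d₂ : ℚ)) := by
  rw [ev3_mul3, ev3_lin3, ev3_lin3]

end VIMInner

end Summit.KontsevichZagierPeriods.Zeta5Search.Certificates
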